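import Mathlib
import Summits.KontsevichZagierPeriods.Zeta5Search.PairCancellationProof
import Summits.KontsevichZagierPeriods.Zeta5Search.CasoratianClassBoundProof
import HarnessLib

/-!
# ζ(5) search — THEOREM V: the constant-term floor `v_p(V(b)) ≥ −N_p(b)` IS A THEOREM in the window `p² > b₀ + 2`

Cell `pub-zeta5` (HONEST FRAMING: systematic search; no irrationality claim unless certified), typer seat
generation 9.  Gen-2 g8's OBSERVED law (V-floor) — `ConstantTermFloorLaw` of `Zeta5Search/ClusterValuationResidues.lean` §4,
stated there for EVERY prime `p ≥ 5` — is proved here for every prime of the window `p² > b₀ + 2` (REPORT-gen2-g8 §2,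
"THEOREM V"; the residual range `p² ≤ b₀ + 2`, several class points per level, stays OBSERVED: 112 + 531 exact pairs there):

* `constantTermFloorLaw_window : InPolytope b → p.Prime → 5 ≤ p → b₀ + 2 < p² → V(b) ≠ 0 → −N_p(b) ≤ v_p(V(b))`;
* `casoratianValuationLaw_of_kRes : KResCasoratianLaw → CasoratianValuationLaw` — gen-2 g8's road `cvRoad` with three of its four
  inputs now discharged (`momentVanishing_holds`, `momentIntegral_holds`, typer g7; THEOREM V here): **(CV) in the window rests on
  the observed law (CV-𝒦) alone.**

PROOF (REPORT-gen2-g8 §2, all ingredients are tree theorems): `V = Σ_{x<p} V_x` (`coeffV_eq_sum_classV`).  A class without poles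
has `V_x = 0`; a single-pole class has `v(V_x) ≥ ν_x ≥ −N_p` (`classNuBound_holds`; a non-tame class has a neutral point below its
pole, so `SinglePoleExpBound` (typer g8) bounds the pole order by `N_p`); a multipole class has `E_x ≥ −N_p − 1`
(`ClassExpLowerBound`, typer g8) and `v(V_x) ≥ E_x` (`ClassVBound`), which settles `E_x ≥ −N_p`; the EXTREMAL classes
`E_x = −N_p − 1` are permuted without fixed points by the conjugation `x ↦ x̄` (`ClassExpRigidity`, typer g9, and the reflection
invariance of the class data proved here: `classExp_conj`, `classPoleCount_conj`, `conjClass_conjClass`), so twice their sum is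
`Σ_x (V_x + V_x̄)`, each term of valuation `≥ −N_p` by `PairCancellation` (typer g9); `‖2‖_p = 1`.  Ultrametric inequality.
`p`-adic norms of rational numbers; nothing about irrationality.
-/

noncomputable section

open Finset

namespace Summit.KontsevichZagierPeriods.Zeta5Search.ClusterValuation

open Summit.KontsevichZagierPeriods.Zeta5Search.DualSeries (InBox)
open Summit.KontsevichZagierPeriods.Zeta5Search.WedgeDictionary (coeffV pfData dOf)
open Summit.KontsevichZagierPeriods.Zeta5Search.CasoratianValuation (InPolytope pairFloors refund shift casoratian
  CasoratianValuationLaw)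
open Summit.KontsevichZagierPeriods.Zeta5Search.BigPrime (block)
open Summit.KontsevichZagierPeriods.Zeta5Search.PadicSeries

/-! ### Reflection `s ↦ b₀ − s` of the class data -/

section Reflect

variable (b : ℕ → ℤ) (h0 : 0 ≤ b 0)

/-- The depth is reflection invariant: `depth(b₀ − s) = depth(s)`. -/
theorem blockCount_reflect {s : ℕ} (hs : s ≤ (b 0).toNat) : blockCount b ((b 0).toNat - s) = blockCount b s := by
  unfold blockCount
  congr 1
  ext j
  simp only [mem_filter, mem_range, block, mem_Icc]
  constructor
  · rintro ⟨hj, h1, h2⟩; exact ⟨hj, by omega, by omega⟩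
  · rintro ⟨hj, h1, h2⟩; exact ⟨hj, by omega, by omega⟩

include h0 in
/-- The net exponent is reflection invariant: `netExp(b₀ − s) = netExp(s)`. -/
theorem netExp_reflect {s : ℕ} (hs : s ≤ (b 0).toNat) : netExp b ((b 0).toNat - s) = netExp b s := by
  unfold netExp
  rw [blockCount_reflect b hs]
  have hb0 : (((b 0).toNat : ℕ) : ℤ) = b 0 := Int.toNat_of_nonneg h0
  push_cast [Nat.cast_sub hs]
  split_ifs <;> omega

/-- A class point lies in `[0, b₀]`. -/
theorem le_of_mem_classSet {p x s : ℕ} (hs : s ∈ classSet b p x) : s ≤ (b 0).toNat := by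
  have := (mem_filter.1 hs).1
  rw [mem_range] at this
  omega

/-- Membership in the conjugate class: `s ∈ class(x̄) ↔ b₀ − s ∈ class(x)` (`s, x ≤ b₀`). -/
theorem mem_classSet_conj_iff {p x s : ℕ} (hx : x ≤ (b 0).toNat) (hs : s ≤ (b 0).toNat) :
    s ∈ classSet b p (conjClass b p x) ↔ (b 0).toNat - s ∈ classSet b p x := by
  set n := (b 0).toNat with hn
  simp only [classSet, conjClass, mem_filter, mem_range, Nat.mod_mod]
  constructor
  · rintro ⟨_, h⟩
    refine ⟨by omega, ?_⟩
    have h1 : n ≡ s + x [MOD p] := by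
      have := Nat.ModEq.add_right x ((h : s ≡ n - x [MOD p]).symm)
      rwa [Nat.sub_add_cancel hx] at this
    have h2 : (n - s) + s ≡ x + s [MOD p] := by
      rw [Nat.sub_add_cancel hs, add_comm x s]; exact h1
    exact Nat.ModEq.add_right_cancel' s h2
  · rintro ⟨_, h⟩
    refine ⟨by omega, ?_⟩
    have h1 : n ≡ x + s [MOD p] := by
      have := Nat.ModEq.add_right s (h : n - s ≡ x [MOD p])
      rwa [Nat.sub_add_cancel hs] at this
    have h2 : (n - x) + x ≡ s + x [MOD p] := by
      rw [Nat.sub_add_cancel hx, add_comm s x]; exact h1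
    exact (Nat.ModEq.add_right_cancel' x h2).symm

/-- The conjugate class is the reflected class. -/
theorem classSet_conj {p x : ℕ} (hx : x ≤ (b 0).toNat) :
    classSet b p (conjClass b p x) = (classSet b p x).image (fun s => (b 0).toNat - s) := by
  ext s
  rw [mem_image]
  constructor
  · intro hs
    have hsn : s ≤ (b 0).toNat := le_of_mem_classSet b hs
    exact ⟨(b 0).toNat - s, (mem_classSet_conj_iff b hx hsn).1 hs, by omega⟩
  · rintro ⟨t, ht, rfl⟩
    have htn : t ≤ (b 0).toNat := le_of_mem_classSet b ht
    refine (mem_classSet_conj_iff b hx (by omega)).2 ?_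
    rwa [Nat.sub_sub_self htn]

/-- The reflection is injective on a class. -/
theorem reflect_injOn {p x : ℕ} : Set.InjOn (fun s => (b 0).toNat - s) ↑(classSet b p x) := by
  intro s hs t ht hst
  have hs' := le_of_mem_classSet b (Finset.mem_coe.1 hs)
  have ht' := le_of_mem_classSet b (Finset.mem_coe.1 ht)
  simp only at hst
  omega

include h0 in
/-- The centre lies in the conjugate class iff it lies in the class. -/
theorem centreIn_conj_iff {p x : ℕ} (hx : x ≤ (b 0).toNat) : CentreIn b p (conjClass b p x) ↔ CentreIn b p x := by
  unfold CentreIn conjClass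
  set n := (b 0).toNat with hn
  have hb0 : (n : ℤ) = b 0 := Int.toNat_of_nonneg h0
  have hdm := Nat.div_add_mod (n - x) p
  set d := (n - x) / p
  set y := (n - x) % p
  have hy : (y : ℤ) = (n : ℤ) - x - p * d := by
    have : ((p * d + y : ℕ) : ℤ) = ((n - x : ℕ) : ℤ) := by rw [hdm]
    push_cast [Nat.cast_sub hx] at this
    linarith
  have e : 2 * (y : ℤ) - b 0 = (p : ℤ) * (-2 * d) + -(2 * (x : ℤ) - b 0) := by rw [hy, ← hb0]; ring
  rw [e, dvd_add_right (dvd_mul_right _ _), dvd_neg]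

include h0 in
/-- **The class exponent is conjugation invariant**: `E_x̄ = E_x`. -/
theorem classExp_conj {p x : ℕ} (hx : x ≤ (b 0).toNat) : classExp b p (conjClass b p x) = classExp b p x := by
  unfold classExp
  rw [classSet_conj b hx, sum_image (reflect_injOn b)]
  have hsum : ∑ t ∈ classSet b p x, netExp b ((b 0).toNat - t) = ∑ t ∈ classSet b p x, netExp b t :=
    sum_congr rfl fun t ht => netExp_reflect b h0 (le_of_mem_classSet b ht)
  rw [hsum]
  by_cases hc : CentreIn b p x
  · have hc' : CentreIn b p (conjClass b p x) := (centreIn_conj_iff b h0 hx).2 hc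
    simp only [hc, hc']
  · have hc' : ¬ CentreIn b p (conjClass b p x) := fun h => hc ((centreIn_conj_iff b h0 hx).1 h)
    simp only [hc, hc']

include h0 in
/-- **The pole count is conjugation invariant.** -/
theorem classPoleCount_conj {p x : ℕ} (hx : x ≤ (b 0).toNat) :
    classPoleCount b p (conjClass b p x) = classPoleCount b p x := by
  unfold classPoleCount
  rw [classSet_conj b hx, filter_image, card_image_of_injOn]
  · exact congrArg Finset.card
      (filter_congr fun t ht => by rw [netExp_reflect b h0 (le_of_mem_classSet b ht)])
  · exact (reflect_injOn b).mono (coe_subset.2 (filter_subset _ _))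

/-- Conjugation is an involution on the residues `x < p ≤ b₀`. -/
theorem conjClass_conjClass {p x : ℕ} (hx : x < p) (hpn : p ≤ (b 0).toNat) :
    conjClass b p (conjClass b p x) = x := by
  unfold conjClass
  set n := (b 0).toNat with hn
  have hdm := Nat.div_add_mod (n - x) p
  have hle : (n - x) % p ≤ n - x := Nat.mod_le _ _
  have e : n - (n - x) % p = x + p * ((n - x) / p) := by omega
  rw [e, Nat.add_mul_mod_self_left, Nat.mod_eq_of_lt hx]

/-- The conjugate residue is a residue. -/
theorem conjClass_lt {p : ℕ} (hp : 0 < p) (x : ℕ) : conjClass b p x < p := Nat.mod_lt _ hp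

/-- Two distinct points of one class force `p ≤ b₀`. -/
theorem p_le_of_two_mem {p x u v : ℕ} (hp : 0 < p) (hu : u ∈ classSet b p x) (hv : v ∈ classSet b p x)
    (huv : u ≠ v) : p ≤ (b 0).toNat := by
  have hu' := le_of_mem_classSet b hu
  have hv' := le_of_mem_classSet b hv
  obtain ⟨k, hk⟩ := dvd_sub_of_mem_classSet b hu hv
  rcases lt_or_gt_of_ne huv with h | h
  · have hk1 : k ≤ -1 := by
      by_contra hk'
      push Not at hk'
      have : (p : ℤ) * 0 ≤ (p : ℤ) * k := mul_le_mul_of_nonneg_left (by omega) (by omega)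
      omega
    have : (p : ℤ) * k ≤ (p : ℤ) * (-1) := mul_le_mul_of_nonneg_left hk1 (by omega)
    omega
  · have hk1 : 1 ≤ k := by
      by_contra hk'
      push Not at hk'
      have : (p : ℤ) * k ≤ (p : ℤ) * 0 := mul_le_mul_of_nonneg_left (by omega) (by omega)
      omega
    have : (p : ℤ) * 1 ≤ (p : ℤ) * k := mul_le_mul_of_nonneg_left hk1 (by omega)
    omega

end Reflect

/-! ### THEOREM V in the window -/

variable {p : ℕ} [hp : Fact p.Prime]

/-- **Single-pole and non-extremal multipole classes: `ν_x ≥ −N_p`.** -/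
theorem neg_pairFloors_le_classNu (b : ℕ → ℤ) (hb : InPolytope b) (hp5 : 5 ≤ p) (hwin : (b 0 + 2 : ℤ) < (p : ℤ) ^ 2)
    {x : ℕ} (hx : x < p) (hpole : 1 ≤ classPoleCount b p x)
    (hnot : ¬ (2 ≤ classPoleCount b p x ∧ classExp b p x = -(pairFloors b p + 1))) :
    -pairFloors b p ≤ classNu b p x := by
  have hN := pairFloors_nonneg b hb p
  have hp0 : 0 < p := hp.out.pos
  have h0 : 0 ≤ b 0 := hb.1.1
  have hb0 : (((b 0).toNat : ℕ) : ℤ) = b 0 := Int.toNat_of_nonneg h0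
  have hodd : ¬ 2 ∣ p := by
    intro h2
    have := (Nat.prime_dvd_prime_iff_eq Nat.prime_two hp.out).1 h2
    omega
  unfold classNu
  split_ifs with htame
  · exact le_trans (by linarith) (le_max_right _ _)
  · by_cases hc1 : classPoleCount b p x = 1
    · -- a single pole, not tame: a neutral point lies below the pole, which is above level 0
      have hnt : ¬ (tameSingle b p x = true) := fun h => htame ⟨hc1, h⟩
      rw [tameSingle_iff] at hnt
      push Not at hnt
      obtain ⟨q, hq⟩ := card_pos.1 (by unfold classPoleCount at hc1; omega :
        0 < ((classSet b p x).filter fun s => netExp b s < 0).card)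
      obtain ⟨hqmem, hqpole⟩ := mem_filter.1 hq
      obtain ⟨hqp, s, hs, hsq, hsle⟩ := hnt q hqmem hqpole
      have hs0 : netExp b s = 0 :=
        le_antisymm hsle (netExp_nonneg_of_unique_pole b hc1 hqmem hqpole hs (by omega))
      have hpb : (p : ℤ) ≤ b 0 := by
        have := le_of_mem_classSet b hqmem
        omega
      have hge := singlePoleExpBound_holds b p x q s hb hp5 hodd hpb hwin hx hc1 hqmem hqpole hs hsq hs0
      have hE : netExp b q ≤ classExp b p x := by
        unfold classExp
        have h1 : netExp b q ≤ ∑ t ∈ classSet b p x, netExp b t := by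
          rw [← add_sum_erase _ _ hqmem]
          have : 0 ≤ ∑ t ∈ (classSet b p x).erase q, netExp b t :=
            sum_nonneg fun t ht => netExp_nonneg_of_unique_pole b hc1 hqmem hqpole (mem_of_mem_erase ht)
              (ne_of_mem_erase ht)
          linarith
        have h2 : (0 : ℤ) ≤ (if ¬ (2 : ℤ) ∣ b 0 ∧ CentreIn b p x then 1 else 0) := by split_ifs <;> norm_num
        linarith
      linarith
    · -- a non-extremal multipole class
      have hc2 : 2 ≤ classPoleCount b p x := by omega
      obtain ⟨u, hu, v, hv, huv⟩ := one_lt_card.1 (by unfold classPoleCount at hc2; omega :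
        1 < ((classSet b p x).filter fun s => netExp b s < 0).card)
      have hpn := p_le_of_two_mem b hp0 (mem_filter.1 hu).1 (mem_filter.1 hv).1 huv
      have hpb : (p : ℤ) ≤ b 0 := by omega
      have hV1 := classExpLowerBound_holds b p x hb hp5 hodd hpb hwin hx hc2
      have hne : classExp b p x ≠ -(pairFloors b p + 1) := fun h => hnot ⟨hc2, h⟩
      omega

/-- **THEOREM V (the constant-term floor in the window).**  For `b` in the polytope and a prime `p ≥ 5` with `p² > b₀ + 2`:
`v_p(V(b)) ≥ −N_p(b)`.  (`ConstantTermFloorLaw` restricted to the window; the range `p² ≤ b₀ + 2` is not covered.) -/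
theorem constantTermFloorLaw_window (b : ℕ → ℤ) (p : ℕ) (hb : InPolytope b) (hprime : p.Prime) (hp5 : 5 ≤ p)
    (hwin : (b 0 + 2 : ℤ) < (p : ℤ) ^ 2) (hV : coeffV b ≠ 0) :
    -pairFloors b p ≤ padicValRat p (coeffV b) := by
  haveI : Fact p.Prime := ⟨hprime⟩
  set N := pairFloors b p with hN
  have h0 : 0 ≤ b 0 := hb.1.1
  have hb0 : (((b 0).toNat : ℕ) : ℤ) = b 0 := Int.toNat_of_nonneg h0
  have hp0 : 0 < p := hprime.pos
  have hp1 : (1 : ℚ) < p := by exact_mod_cast hprime.one_lt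
  have hodd : ¬ 2 ∣ p := by
    intro h2
    have := (Nat.prime_dvd_prime_iff_eq Nat.prime_two hprime).1 h2
    omega
  -- a norm bound suffices
  suffices hnorm : padicNorm p (coeffV b) ≤ (p : ℚ) ^ N by
    rw [padicNorm.eq_zpow_of_nonzero hV] at hnorm
    have := (zpow_le_zpow_iff_right₀ hp1).1 hnorm
    linarith
  rw [coeffV_eq_sum_classV b hp0,
    ← sum_filter_add_sum_filter_not (range p) (fun x => 2 ≤ classPoleCount b p x ∧ classExp b p x = -(N + 1))]
  set A := (range p).filter (fun x => 2 ≤ classPoleCount b p x ∧ classExp b p x = -(N + 1)) with hA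
  refine (padicNorm.nonarchimedean (p := p)).trans (max_le ?_ ?_)
  · -- the extremal classes, paired with their conjugates
    by_cases hpn : p ≤ (b 0).toNat
    · have hpb : (p : ℤ) ≤ b 0 := by omega
      have hmem : ∀ x ∈ A, x < p ∧ 2 ≤ classPoleCount b p x ∧ classExp b p x = -(N + 1) := fun x hx => by
        obtain ⟨hxr, h⟩ := mem_filter.1 hx
        exact ⟨mem_range.1 hxr, h⟩
      have hmapsA : ∀ x ∈ A, conjClass b p x ∈ A := by
        intro x hx
        obtain ⟨hx', hc2, hE⟩ := hmem x hx
        refine mem_filter.2 ⟨mem_range.2 (conjClass_lt b hp0 x), ?_, ?_⟩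
        · rwa [classPoleCount_conj b h0 (by omega)]
        · rwa [classExp_conj b h0 (by omega)]
      have hinv : ∀ x ∈ A, conjClass b p (conjClass b p x) = x := fun x hx =>
        conjClass_conjClass b (hmem x hx).1 hpn
      have hpair : ∑ x ∈ A, classV b p (conjClass b p x) = ∑ x ∈ A, classV b p x :=
        sum_nbij' (conjClass b p) (conjClass b p) hmapsA hmapsA hinv hinv (fun _ _ => rfl)
      have h2 : (2 : ℚ) * ∑ x ∈ A, classV b p x = ∑ x ∈ A, (classV b p x + classV b p (conjClass b p x)) := by
        rw [sum_add_distrib, hpair, two_mul]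
      have hn2 : padicNorm p (2 : ℚ) = 1 := by
        have := (padicNorm.nat_eq_one_iff (p := p) 2).2 (by
          intro h; have := (Nat.prime_dvd_prime_iff_eq hprime Nat.prime_two).1 h; omega)
        exact_mod_cast this
      calc padicNorm p (∑ x ∈ A, classV b p x)
          = padicNorm p ((2 : ℚ) * ∑ x ∈ A, classV b p x) := by rw [padicNorm.mul, hn2, one_mul]
        _ = padicNorm p (∑ x ∈ A, (classV b p x + classV b p (conjClass b p x))) := by rw [h2]
        _ ≤ (p : ℚ) ^ N := by
          refine padicNorm.sum_le' (fun x hx => ?_) (zpow_p_nonneg _)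
          obtain ⟨hx', hc2, hE⟩ := hmem x hx
          have h := padicNorm_le_of_val (p := p) (m := -N) fun hne =>
            pairCancellation_holds b p x hb hprime hp5 hpb hwin hx' hc2 hE hne
          rwa [neg_neg] at h
    · -- `p > b₀`: no class has two points, `A = ∅`
      have hA0 : A = ∅ := by
        refine eq_empty_of_forall_notMem fun x hx => hpn ?_
        obtain ⟨_, hc2, _⟩ := mem_filter.1 hx
        obtain ⟨u, hu, v, hv, huv⟩ := one_lt_card.1 (by unfold classPoleCount at hc2; omega :
          1 < ((classSet b p x).filter fun s => netExp b s < 0).card)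
        exact p_le_of_two_mem b hp0 (mem_filter.1 hu).1 (mem_filter.1 hv).1 huv
      rw [hA0, sum_empty, padicNorm.zero]
      exact zpow_p_nonneg _
  · -- all other classes, one at a time
    refine padicNorm.sum_le' (fun x hx => ?_) (zpow_p_nonneg _)
    obtain ⟨hxr, hnot⟩ := mem_filter.1 hx
    have hx' := mem_range.1 hxr
    rcases Nat.eq_zero_or_pos (classPoleCount b p x) with hc0 | hcpos
    · rw [classV_eq_zero_of_noPole b hb hc0, padicNorm.zero]
      exact zpow_p_nonneg _
    · have hnu := neg_pairFloors_le_classNu b hb hp5 hwin hx' hcpos hnot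
      exact (padicNorm_classV_le b hb hp5 hwin hx' hcpos).trans (zpow_le_zpow_right₀ one_le_p (by linarith))

/-! ### (CV) in the window now rests on (CV-𝒦) alone -/

/-- **(CV) ⇐ (CV-𝒦).**  Gen-2 g8's road `cvRoad` with `MomentVanishing`, `MomentIntegral` (typer g7) and THEOREM V (above)
discharged: the observed law `KResCasoratianLaw` alone implies `CasoratianValuationLaw`.  (The proof is `cvRoad`'s, with the
window form of the constant-term floor; `b + e_j` has the same `b₀`, hence the same window.) -/
theorem casoratianValuationLaw_of_kRes (hK : KResCasoratianLaw) : CasoratianValuationLaw := by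
  intro b j p hb hj1 hj7 hb' hpp h5 hwin hcas
  haveI : Fact p.Prime := ⟨hpp⟩
  have hp1 : (1 : ℚ) < p := by exact_mod_cast hpp.one_lt
  have hd0 : 0 ≤ dOf b := by
    have := hb.2.2; unfold dOf; linarith
  have hdshift : dOf (shift b j) = dOf b - 1 := BigPrime.dOf_shift b hj1 hj7
  have hN' : pairFloors (shift b j) p ≤ pairFloors b p := pairFloors_shift_le b hj1 p hpp.pos
  have hwin' : (shift b j 0 + 2 : ℤ) < (p : ℤ) ^ 2 := by rwa [BigPrime.shift_zero b hj1]
  -- the constant terms (THEOREM V for `b` and `b + e_j`)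
  have hVb : padicNorm p (coeffV b) ≤ (p : ℚ) ^ pairFloors b p := by
    have h1 := padicNorm_le_of_val (p := p) (x := coeffV b) (m := -pairFloors b p)
      (fun h => constantTermFloorLaw_window b p hb hpp h5 hwin h)
    simpa using h1
  have hVb' : padicNorm p (coeffV (shift b j)) ≤ (p : ℚ) ^ pairFloors b p := by
    have h1 := padicNorm_le_of_val (p := p) (x := coeffV (shift b j)) (m := -pairFloors (shift b j) p)
      (fun h => constantTermFloorLaw_window (shift b j) p hb' hpp h5 hwin' h)
    refine h1.trans ?_
    rw [neg_neg]; exact zpow_le_zpow_right₀ hp1.le hN'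
  -- the 𝒦-bracket
  have hBb : padicNorm p (kRes (shift b j) p * coeffV b - kRes b p * coeffV (shift b j))
      ≤ (p : ℚ) ^ (-(1 - pairFloors b p)) :=
    padicNorm_le_of_val (fun h => hK b j p hb hj1 hj7 hb' hpp h5 hwin h)
  -- the moments
  have hΩint : ∀ b' : ℕ → ℤ, InPolytope b' → padicNorm p (omegaRes b' p) ≤ 1 := fun b' hb'' =>
    padicNorm_omegaRes_le_one b' hb'' (by omega)
  have hΩzero : ∀ b' : ℕ → ℤ, InPolytope b' → (p : ℤ) ≤ dOf b' + 1 → omegaRes b' p = 0 := fun b' hb'' hpd =>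
    omegaRes_eq_zero b' hb'' hpd
  -- assemble
  apply val_ge_of_padicNorm_le hcas
  rw [casoratian_split b j p]
  by_cases hpd : (p : ℤ) ≤ dOf b
  · have h1 : omegaRes b p = 0 := hΩzero b hb (by omega)
    have h2 : omegaRes (shift b j) p = 0 := hΩzero _ hb' (by rw [hdshift]; omega)
    rw [h1, h2, zero_mul, zero_mul, sub_zero, zero_sub, padicNorm.neg]
    refine hBb.trans (zpow_le_zpow_right₀ hp1.le ?_)
    have : refund b p ≤ 1 := min_le_left _ _
    linarith
  · have hr : refund b p = 0 := by
      unfold refund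
      rw [Int.ediv_eq_zero_of_lt hd0 (by omega)]; simp
    rw [hr, zero_sub, neg_neg]
    calc padicNorm p ((omegaRes (shift b j) p * coeffV b - omegaRes b p * coeffV (shift b j))
            - (kRes (shift b j) p * coeffV b - kRes b p * coeffV (shift b j)))
        ≤ max (padicNorm p (omegaRes (shift b j) p * coeffV b - omegaRes b p * coeffV (shift b j)))
            (padicNorm p (kRes (shift b j) p * coeffV b - kRes b p * coeffV (shift b j))) := padicNorm.sub
      _ ≤ (p : ℚ) ^ pairFloors b p := max_le ?_ ?_
    · calc padicNorm p (omegaRes (shift b j) p * coeffV b - omegaRes b p * coeffV (shift b j))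
          ≤ max (padicNorm p (omegaRes (shift b j) p * coeffV b)) (padicNorm p (omegaRes b p * coeffV (shift b j))) :=
            padicNorm.sub
        _ ≤ (p : ℚ) ^ pairFloors b p := max_le ?_ ?_
      · rw [padicNorm.mul]
        calc padicNorm p (omegaRes (shift b j) p) * padicNorm p (coeffV b) ≤ 1 * (p : ℚ) ^ pairFloors b p :=
              mul_le_mul (hΩint _ hb') hVb (padicNorm.nonneg _) zero_le_one
          _ = _ := one_mul _
      · rw [padicNorm.mul]
        calc padicNorm p (omegaRes b p) * padicNorm p (coeffV (shift b j)) ≤ 1 * (p : ℚ) ^ pairFloors b p :=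
              mul_le_mul (hΩint _ hb) hVb' (padicNorm.nonneg _) zero_le_one
          _ = _ := one_mul _
    · refine hBb.trans (zpow_le_zpow_right₀ hp1.le ?_)
      linarith

end Summit.KontsevichZagierPeriods.Zeta5Search.ClusterValuation

end
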